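import Mathlib
import Summits.Ventures.PercRepro2.Defs
import Summits.Ventures.PercRepro2.Harris
import Summits.Ventures.PercRepro2.Graph
import Summits.Ventures.PercRepro2.Events
import Summits.Ventures.PercRepro2.Induced
import Summits.Ventures.PercRepro2.BHK
import Summits.Ventures.PercRepro2.BHKEvents
import Summits.Ventures.PercRepro2.VdBKahn
import Summits.Ventures.PercRepro2.BHKAvoid

/-!
# The lemma of record `(K′)` of the `(C-MONO)` chain, and its robust form `(K′-S)`:
`KPrime.kprimeS_imp_kprime` (blind cell PercRepro2, mine-c g31; `conjectures/MINE-C.md` §39.10, §40.1)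

Roots `a₁, a₂`, a mark `b`, vertices `v, y`; `Ω = {a₁ ↮ a₂}`, `S = {a₂ ↮ {a₁, v}}`,
`N = {a₁ ↮ {a₂, v}}` (= `Ω ∩ {v ∉ C₁}`); `U = {v ∈ C₁}`, `X = {b ∈ C₁}`, `Y = {y ∈ C₂}`,
`W = {y ∈ C₁}`, `Cv = {b ∈ C(v)}`, `V₂ = {v ∈ C₂}`.  With `ν = P(· | Ω)` and `ν_S = P(· | S)`,
the candidate `(K′)(E)` reads

  `(ν(U ∩ X) − E ν(U)) · ν_S(Y) + (ν((0,1), b ∈ C₁ ∪ C(v)) − E ν((0,1))) − (ν((1,2), b ∈ C₁) − E ν((1,2))) ≥ 0`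

(class `(0,1) = {v free, y ∈ C₁} = Uᶜ ∩ W ∩ S`, class `(1,2) = U ∩ Y`), and `(K′)` is the case
`E = E₀ = ν(b ∈ C₁ | v ∉ C₁) = P(X ∩ N)/P(N)`, `(K′-S)` the case `E = E₀ˢ = ν(b ∈ C₁ | v free)
= P(X ∩ N ∩ V₂ᶜ)/P(N ∩ V₂ᶜ)`.  `kprimeForm ends a₁ a₂ b v y p N₀ D₀` is `(K′)(N₀/D₀)` multiplied
by the positive normalisation `D₀ · P(S) · P(Ω)²` (no division); `(K′)` is
`0 ≤ kprimeForm … (P(X ∩ N)) (P(N))` and `(K′-S)` is `0 ≤ kprimeForm … (P(X ∩ N ∩ V₂ᶜ)) (P(N ∩ V₂ᶜ))`.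

**Theorem** (`kprimeS_imp_kprime`): `(K′-S) → (K′)`.  Two BHK06 1.4 instances with set avoidance
(`bhk_cross_cluster_avoid`): (i) `E₀ ≤ E₀ˢ` — in `N` the events `b ∈ C₁` and `v ∈ C₂` are
negatively correlated; (ii) the `E`-slope of `(K′)(E)` is `≤ 0` — in `S` the events `v ∈ C₁` and
`y ∈ C₂` are negatively correlated (`ν((1,2)) ≤ ν(U) ν_S(Y)`); hence `(K′)(E)` is non-increasing in
`E` and the `E₀ˢ` form implies the `E₀` form.  Neither conjecture is proved here; the file fixes the
statements and their order (`(K′-S)` is the stronger one; `MINE-C.md` §40.1).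
-/

namespace Summit.Ventures.PercRepro2

namespace KPrime

variable {V : Type*} {E : Type*} [Fintype E] [DecidableEq E] [Fintype V] [DecidableEq V]
  {R : Type*} [Field R] [LinearOrder R] [IsStrictOrderedRing R]

section Events

variable (ends : E → Sym2 V) (a₁ a₂ b v y : V)

/-- The world `Ω = {a₁ ↮ a₂}`. -/
def Ω : Set (Config E) := avoidAll ends a₁ {a₂}

/-- The world `S = {a₂ ↮ {a₁, v}}` (`v ∉ C₂` inside `Ω`). -/
def S : Set (Config E) := avoidAll ends a₂ {a₁, v}

/-- The world `N = {a₁ ↮ {a₂, v}}` (`v ∉ C₁` inside `Ω`). -/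
def N : Set (Config E) := avoidAll ends a₁ {a₂, v}

/-- The class `(0,1)` with the glued mark: `v` free, `y ∈ C₁`, `b ∈ C₁ ∪ C(v)`. -/
def cls01e : Set (Config E) :=
  (connEvent ends a₁ v)ᶜ ∩ connEvent ends a₁ y ∩ S ends a₁ a₂ v ∩
    (connEvent ends a₁ b ∪ connEvent ends v b)

/-- The class `(0,1)`: `v` free, `y ∈ C₁`. -/
def cls01 : Set (Config E) := (connEvent ends a₁ v)ᶜ ∩ connEvent ends a₁ y ∩ S ends a₁ a₂ v

/-- The `(K′)(E)` functional at `E = N₀ / D₀`, cleared of denominators: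
`(P(U∩X∩Ω) D₀ − N₀ P(U∩Ω)) P(Y∩S) + P(S) ((P((0,1)ᵉ) D₀ − N₀ P((0,1))) − (P(U∩Y∩X∩Ω) D₀ − N₀ P(U∩Y∩Ω)))`. -/
noncomputable def kprimeForm (p : E → R) (N₀ D₀ : R) : R :=
  (prob p (connEvent ends a₁ v ∩ connEvent ends a₁ b ∩ Ω ends a₁ a₂) * D₀ -
        N₀ * prob p (connEvent ends a₁ v ∩ Ω ends a₁ a₂)) *
      prob p (connEvent ends a₂ y ∩ S ends a₁ a₂ v) +
    prob p (S ends a₁ a₂ v) *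
      ((prob p (cls01e ends a₁ a₂ b v y) * D₀ - N₀ * prob p (cls01 ends a₁ a₂ v y)) -
        (prob p (connEvent ends a₁ v ∩ connEvent ends a₂ y ∩ connEvent ends a₁ b ∩ Ω ends a₁ a₂) *
            D₀ -
          N₀ * prob p (connEvent ends a₁ v ∩ connEvent ends a₂ y ∩ Ω ends a₁ a₂)))

end Events

section Sets

variable {ends : E → Sym2 V} {a₁ a₂ b v y : V}

omit [Fintype E] [DecidableEq E] [Fintype V] in
/-- Membership in `S`: `a₂ ↮ a₁` and `a₂ ↮ v`. -/
lemma mem_S {ω : Config E} : ω ∈ S ends a₁ a₂ v ↔ ¬ Conn ends ω a₂ a₁ ∧ ¬ Conn ends ω a₂ v := by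
  simp only [S, mem_avoidAll, Finset.mem_insert, Finset.mem_singleton, forall_eq_or_imp, forall_eq]

omit [Fintype E] [DecidableEq E] [Fintype V] [DecidableEq V] in
/-- Membership in `Ω`: `a₁ ↮ a₂`. -/
lemma mem_Ω {ω : Config E} : ω ∈ Ω ends a₁ a₂ ↔ ¬ Conn ends ω a₁ a₂ := by
  simp only [Ω, mem_avoidAll, Finset.mem_singleton, forall_eq]

omit [Fintype E] [DecidableEq E] [Fintype V] in
/-- Membership in `N`: `a₁ ↮ a₂` and `a₁ ↮ v`. -/
lemma mem_N {ω : Config E} : ω ∈ N ends a₁ a₂ v ↔ ¬ Conn ends ω a₁ a₂ ∧ ¬ Conn ends ω a₁ v := by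
  simp only [N, mem_avoidAll, Finset.mem_insert, Finset.mem_singleton, forall_eq_or_imp, forall_eq]

omit [Fintype E] [DecidableEq E] [Fintype V] in
/-- `{v ∈ C₁} ∩ Ω = {v ∈ C₁} ∩ S`: on `v ∈ C₁`, `a₂ ↮ a₁` already forces `a₂ ↮ v`. -/
lemma U_inter_Ω_eq : connEvent ends a₁ v ∩ Ω ends a₁ a₂ = connEvent ends a₁ v ∩ S ends a₁ a₂ v := by
  ext ω
  simp only [Set.mem_inter_iff, mem_connEvent, mem_Ω, mem_S]
  constructor
  · rintro ⟨h1, h2⟩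
    refine ⟨h1, fun h => h2 (conn_symm h), fun h => h2 (conn_trans h1 (conn_symm h))⟩
  · rintro ⟨h1, h2, _⟩
    exact ⟨h1, fun h => h2 (conn_symm h)⟩

omit [Fintype E] [DecidableEq E] [Fintype V] in
/-- `N ∩ {v ∉ C₂} = S ∩ {v ∉ C₁}` (the world «`v` free»). -/
lemma N_inter_compl_eq :
    N ends a₁ a₂ v ∩ (connEvent ends a₂ v)ᶜ = S ends a₁ a₂ v ∩ (connEvent ends a₁ v)ᶜ := by
  ext ω
  simp only [Set.mem_inter_iff, Set.mem_compl_iff, mem_connEvent, mem_N, mem_S]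
  constructor
  · rintro ⟨⟨h1, h2⟩, h3⟩
    exact ⟨⟨fun h => h1 (conn_symm h), h3⟩, h2⟩
  · rintro ⟨⟨h1, h3⟩, h2⟩
    exact ⟨⟨fun h => h1 (conn_symm h), h2⟩, h3⟩

omit [Fintype E] [DecidableEq E] [Fintype V] [DecidableEq V] in
/-- `{C(x) ∋ z} = {x ↔ z}`. -/
lemma clusterInEvent_mem_eq (x z : V) :
    clusterInEvent ends x {K : Set V | z ∈ K} = connEvent ends x z := by
  ext ω; simp only [mem_clusterInEvent, Set.mem_setOf_eq, mem_cluster, mem_connEvent]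

omit [Fintype E] [DecidableEq E] [Fintype V] [DecidableEq V] in
/-- `{K | z ∈ K}` is an up-set of vertex sets. -/
lemma isUpperSet_mem (z : V) : IsUpperSet {K : Set V | z ∈ K} := fun _ _ hST h => hST h

end Sets

section BHK

variable (p : E → R) (ends : E → Sym2 V) (a₁ a₂ b v y : V)

/-- **BHK06 1.4 in `S`**: `P(U ∩ Y ∩ S) · P(S) ≤ P(U ∩ S) · P(Y ∩ S)` — `v ∈ C₁` and `y ∈ C₂` are
negatively correlated when `a₂` avoids `{a₁, v}` (the `E`-slope of `(K′)(E)` is `≤ 0`). -/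
lemma slope_ineq (hp : IsProbVec p) :
    prob p (connEvent ends a₁ v ∩ connEvent ends a₂ y ∩ Ω ends a₁ a₂) * prob p (S ends a₁ a₂ v) ≤
      prob p (connEvent ends a₁ v ∩ Ω ends a₁ a₂) * prob p (connEvent ends a₂ y ∩ S ends a₁ a₂ v) := by
  have ha₁ : a₁ ∈ ({a₁, v} : Finset V) := by simp
  have key := bhk_cross_cluster_avoid p hp ends a₂ a₁ (X := {a₁, v}) ha₁ (isUpperSet_mem y)
    (isUpperSet_mem v)
  rw [clusterInEvent_mem_eq, clusterInEvent_mem_eq] at key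
  have e1 : connEvent ends a₁ v ∩ connEvent ends a₂ y ∩ Ω ends a₁ a₂ =
      connEvent ends a₂ y ∩ connEvent ends a₁ v ∩ S ends a₁ a₂ v := by
    rw [Set.inter_comm (connEvent ends a₁ v) (connEvent ends a₂ y), Set.inter_assoc,
      U_inter_Ω_eq, ← Set.inter_assoc]
  rw [e1, U_inter_Ω_eq, mul_comm (prob p (connEvent ends a₁ v ∩ S ends a₁ a₂ v))]
  simpa only [S] using key

/-- **BHK06 1.4 in `N`**: `P(X ∩ N) · P(N ∩ V₂ᶜ) ≤ P(X ∩ N ∩ V₂ᶜ) · P(N)` — i.e. `E₀ ≤ E₀ˢ`: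
given `a₁ ↮ {a₂, v}`, the events `b ∈ C₁` and `v ∈ C₂` are negatively correlated. -/
lemma E0_le_E0S (hp : IsProbVec p) :
    prob p (connEvent ends a₁ b ∩ N ends a₁ a₂ v) * prob p (N ends a₁ a₂ v ∩ (connEvent ends a₂ v)ᶜ) ≤
      prob p (connEvent ends a₁ b ∩ N ends a₁ a₂ v ∩ (connEvent ends a₂ v)ᶜ) *
        prob p (N ends a₁ a₂ v) := by
  have ha₂ : a₂ ∈ ({a₂, v} : Finset V) := by simp
  have key := bhk_cross_cluster_avoid p hp ends a₁ a₂ (X := {a₂, v}) ha₂ (isUpperSet_mem b)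
    (isUpperSet_mem v)
  rw [clusterInEvent_mem_eq, clusterInEvent_mem_eq] at key
  simp only [N] at key ⊢
  set Nn := avoidAll ends a₁ {a₂, v} with hNn
  set Xb := connEvent ends a₁ b with hXb
  set V₂ := connEvent ends a₂ v with hV₂
  have s1 := prob_inter_add_prob_inter_compl p (Xb ∩ Nn) V₂
  have s2 := prob_inter_add_prob_inter_compl p Nn V₂
  have k1 : Xb ∩ V₂ ∩ Nn = Xb ∩ Nn ∩ V₂ := by
    ext ω; simp only [Set.mem_inter_iff]; tauto
  have k2 : V₂ ∩ Nn = Nn ∩ V₂ := Set.inter_comm _ _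
  rw [k1, k2] at key
  nlinarith [key, s1, s2, prob_nonneg hp (Xb ∩ Nn), prob_nonneg hp Nn, prob_nonneg hp (Xb ∩ Nn ∩ V₂),
    prob_nonneg hp (Nn ∩ V₂), prob_nonneg hp (Xb ∩ Nn ∩ V₂ᶜ), prob_nonneg hp (Nn ∩ V₂ᶜ)]

end BHK

section Main

variable (p : E → R) (ends : E → Sym2 V) (a₁ a₂ b v y : V)

omit [Fintype V] [LinearOrder R] [IsStrictOrderedRing R] in
/-- `kprimeForm` is affine in `(N₀, D₀)`: `kprimeForm N₀ D₀ = A · D₀ − N₀ · B`. -/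
lemma kprimeForm_eq (N₀ D₀ : R) :
    kprimeForm ends a₁ a₂ b v y p N₀ D₀ =
      (prob p (connEvent ends a₁ v ∩ connEvent ends a₁ b ∩ Ω ends a₁ a₂) *
            prob p (connEvent ends a₂ y ∩ S ends a₁ a₂ v) +
          prob p (S ends a₁ a₂ v) * (prob p (cls01e ends a₁ a₂ b v y) -
            prob p (connEvent ends a₁ v ∩ connEvent ends a₂ y ∩ connEvent ends a₁ b ∩
              Ω ends a₁ a₂))) * D₀ -
        N₀ * (prob p (connEvent ends a₁ v ∩ Ω ends a₁ a₂) *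
            prob p (connEvent ends a₂ y ∩ S ends a₁ a₂ v) +
          prob p (S ends a₁ a₂ v) * (prob p (cls01 ends a₁ a₂ v y) -
            prob p (connEvent ends a₁ v ∩ connEvent ends a₂ y ∩ Ω ends a₁ a₂))) := by
  unfold kprimeForm; ring

/-- The `E`-coefficient `B` of `(K′)(E)` is non-negative (BHK06 1.4 in `S`). -/
lemma B_nonneg (hp : IsProbVec p) :
    0 ≤ prob p (connEvent ends a₁ v ∩ Ω ends a₁ a₂) * prob p (connEvent ends a₂ y ∩ S ends a₁ a₂ v) +
      prob p (S ends a₁ a₂ v) * (prob p (cls01 ends a₁ a₂ v y) -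
        prob p (connEvent ends a₁ v ∩ connEvent ends a₂ y ∩ Ω ends a₁ a₂)) := by
  have h := slope_ineq p ends a₁ a₂ v y hp
  have h0 := prob_nonneg hp (S ends a₁ a₂ v)
  have h1 := prob_nonneg hp (cls01 ends a₁ a₂ v y)
  nlinarith [mul_nonneg h0 h1]

/-- **`(K′-S)` implies `(K′)`**: the `E₀ˢ` form of the lemma of record implies its `E₀` form,
wherever `P(v free, a₁ ↮ a₂) > 0`. -/
theorem kprimeS_imp_kprime (hp : IsProbVec p)
    (hD : 0 < prob p (N ends a₁ a₂ v ∩ (connEvent ends a₂ v)ᶜ))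
    (hS : 0 ≤ kprimeForm ends a₁ a₂ b v y p
      (prob p (connEvent ends a₁ b ∩ N ends a₁ a₂ v ∩ (connEvent ends a₂ v)ᶜ))
      (prob p (N ends a₁ a₂ v ∩ (connEvent ends a₂ v)ᶜ))) :
    0 ≤ kprimeForm ends a₁ a₂ b v y p (prob p (connEvent ends a₁ b ∩ N ends a₁ a₂ v))
      (prob p (N ends a₁ a₂ v)) := by
  rw [kprimeForm_eq] at hS ⊢
  have hB := B_nonneg p ends a₁ a₂ v y hp
  have hE := E0_le_E0S p ends a₁ a₂ b v hp
  generalize hA : (prob p (connEvent ends a₁ v ∩ connEvent ends a₁ b ∩ Ω ends a₁ a₂) *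
            prob p (connEvent ends a₂ y ∩ S ends a₁ a₂ v) +
          prob p (S ends a₁ a₂ v) * (prob p (cls01e ends a₁ a₂ b v y) -
            prob p (connEvent ends a₁ v ∩ connEvent ends a₂ y ∩ connEvent ends a₁ b ∩
              Ω ends a₁ a₂))) = A at *
  generalize hBB : (prob p (connEvent ends a₁ v ∩ Ω ends a₁ a₂) *
            prob p (connEvent ends a₂ y ∩ S ends a₁ a₂ v) +
          prob p (S ends a₁ a₂ v) * (prob p (cls01 ends a₁ a₂ v y) -
            prob p (connEvent ends a₁ v ∩ connEvent ends a₂ y ∩ Ω ends a₁ a₂))) = B at *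
  generalize hNS : prob p (connEvent ends a₁ b ∩ N ends a₁ a₂ v ∩ (connEvent ends a₂ v)ᶜ) = NS at *
  generalize hDS : prob p (N ends a₁ a₂ v ∩ (connEvent ends a₂ v)ᶜ) = DS at *
  generalize hN0 : prob p (connEvent ends a₁ b ∩ N ends a₁ a₂ v) = N0 at *
  generalize hD0 : prob p (N ends a₁ a₂ v) = D0 at *
  have hN0' : 0 ≤ N0 := hN0 ▸ prob_nonneg hp _
  have hD0' : 0 ≤ D0 := hD0 ▸ prob_nonneg hp _
  -- A · D0 · DS ≥ NS · B · D0 ≥ N0 · DS · B, then divide by DS > 0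
  have h1 : 0 ≤ (A * D0 - N0 * B) * DS := by
    nlinarith [mul_nonneg hB hD0', mul_nonneg hB (le_of_lt hD), mul_nonneg hD0' (le_of_lt hD),
      mul_nonneg hB hN0']
  exact nonneg_of_mul_nonneg_left h1 hD

end Main

end KPrime

end Summit.Ventures.PercRepro2
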